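import Literature.NumberTheory.Rogawski1990.FinExplicitTransferFactorFormTransport
import Literature.NumberTheory.Rogawski1990.CharIdentityOnTestFunctionsFormSign
import Literature.NumberTheory.Rogawski1990.LocalTransferTransportCanonical
import Literature.NumberTheory.Rogawski1990.LocalTransferExistence
import Literature.NumberTheory.Rogawski1990.RankOneEulerPoincareGlue
import Literature.NumberTheory.Automorphic.LocalStableOrbitalFinite
import Literature.NumberTheory.Automorphic.SmoothCharacterClassLinear
import Literature.NumberTheory.Automorphic.LocalUnitaryIntegralLevel
import Literature.NumberTheory.Automorphic.CMPrincipalSeriesJacquetEvalOne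
import Summits.HodgeConjecture.HodgeConjecture.Theorems.F0P3LocalIrrepAdmissibleThree
import Summits.HodgeConjecture.HodgeConjecture.Theorems.F0P3SpectralPacketHLawsSigned
import Summits.HodgeConjecture.HodgeConjecture.Theorems.F0P3SpectralPacketHTrace
import Summits.HodgeConjecture.HodgeConjecture.Cruxes.H413.Lines.R90_S3_EndoFibreDefsC
import Summits.HodgeConjecture.HodgeConjecture.Theorems.R90S3SplitTransferTransport
import HarnessLib

/-!
# R90 · S3 · FILE B — `R90_S3_CharIdTransportB`: the character-identity data TRANSPORT to the inner form, `ψ_v` and the sign `c_loc = ε_v(H)` [§14.4 p. 237, (14.6.3) p. 243]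

R90-TF SLAB (brief v2 1f40d54518340a35), section S3, dealer R90-C12-plan (g0); FILE B PLAN v1.2 path (α) (RULING S3-R1 J-b, LEAD #8 JQ-S3-1, LEAD #14 (2) JQ-S4-A2).
S4's DEFINED `rogawskiLocalKit(H)` at a NON-SPLIT finite `v` reads S3's socket A1 (`R90_S3_EndoCharIdentityA.stub_R90_S3_endoExpansion_exists`) at the
QUASI-SPLIT form `Φ₃` with the TRANSPORTED record data — right Haar measure `(e_v⁻¹)_* ν′`, orbital family `(e_v⁻¹)_* m′_G`, factor `Δ‴_v^{Φ₃}` — along the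
frame of record `ψ_v = e_v⁻¹`, `e_v := cmDatumLocalCongr L v T ha h : U(Φ₃)_v ≃ₜ* U(H)_v` (`ᵗ(σT)·H_v·T = a·Φ₃`).  This file (imports: ★ + file C) PROVES the
transport book-keeping that makes that reading the (KT2″) `v`-clause of ★ `SpectralPacketH.CharIdentityψS` (`trPktH … fH = (s v : ℂ) * endoTrPkt ((νG′ v).map
(ψ v)) … (f′ ∘ (ψ v).symm)`, `s v = formSignAt …`):

* §1 `isLocalDeltaTransfer_finExplicit_transport_iff` — **(4.9.1)-matchings transport along `e_v` with the sign `χ(a)`**: `(f^H, g)` is `Δ‴^{H}`-matched for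
  `m′_G` iff `(f^H, χ(a)·(g ∘ e_v))` is `Δ‴^{Φ₃}`-matched for `(e_v⁻¹)_* m′_G` (★ `finsum_finExplicitDelta_mul_classOrbitalIntegral_transport`, ★
  `isUnit_eval_finCharpolyTwo_of_isLocalGRegular`, `χ(a)² = 1`); `χ(a) = ε_v(H) = formSignAt` (★ `clauseSign_eq_intCast_formSignAt`).
* §2 `isLocalDeltaTransferExists_finExplicit_transport_iff` — Prop. 4.9.1 (a) on `C_c^∞` transports (feeds A1's `hT` at `Φ₃` from the consumer's at `H`);
  `transport_isCanonical_of_record` (★ `transport_isCanonical_isRegularElt` at `e_v`; A1's `hm.2`), `isMulRightInvariant_map_continuousMulEquiv` (A1's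
  `[νG.IsMulRightInvariant]`; the Haar property is Mathlib's instance `ContinuousMulEquiv.isHaarMeasure_map`).
* §3 `cLocOfRecord L H v := formSignAt L c H v` — EXPORT-EDGES row #9 (S7), with `_mul_self`, `_ne_zero`, `_eq_one_of_split`.
* §4 `kt2Clause_of_endoExpansion` — THE JUNCTION: an endoscopic expansion `c` at the transported `Φ₃`-data (the body of file C's `IsEndoExpansion`, taken
  UNFOLDED so that this file imports ★ only; feed it by the `IsEndoExpansion` proof itself) gives, for every `Δ‴^{H}`-matched smooth pair `(f^H, g)`,
  `Σ_{σ∈ρ} tr σ(f^H) = ε_v(H) · Σ_π c(π) tr π((e_v⁻¹)_* ν′; g ∘ e_v)` — S4∕S7 discharge (KT2″) by `rfl`-unfolding `trPktH`∕`endoTrPkt` + this + A1 + C's `endoCoeff_spec`.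
* §5 (ED. 2) `kt2Clause_of_endoExpansion_allPlaces` — §4 at EVERY finite place, NO guard (RULING S3-R5″ (ii)): the matching transports along `e_v` with the form
  sign `ε_v(H)` uniformly in `v` by ★ `isLocalDeltaTransfer_finExplicit_transport_iff_formSignAt` (K2E3-p36, `Theorems/R90S3SplitTransferTransport.lean`, imported —
  payments flow UP, L9: at a non-split `v` the frame sign `χ(a)` of §1, at a split `v` the sign `1` since `κ_v ≡ +1`); `kt2Clause_of_isEndoExpansion` — the same with
  `hc` BY NAME as file C's `IsEndoExpansion` (C imported from ED. 2; δ-equal to the unfolded hypothesis).  NO split-place socket in this file (S3-R5″: the one split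
  socket `stub_R90_S3_endoExpansion_exists_split` lives in FILE A ED. 2 and instantiates `hc` at a split `v` in the consumer, as A1 does at a non-split `v`).
* §6 (ED. 2) `kt2Clause_of_transport_of_isEndoExpansion` — the clause IN ★ KIT CURRENCY (`K.trPktH νH R f^H = s · K.endoTrPkt ((ψ)_* ν′) R (f′ ∘ ψ⁻¹)`) for a
  GENERIC frame `ψ`, generic sign `s` and a BOUND kit `K` reading `mem (xiH R) = c.support`, `pair R = ⇑c`; `charIdentityψS_of_transport_of_isEndoExpansion` — its
  assembly over all finite `v` to the LITERAL ★ `SpectralPacketH.CharIdentityψS ψ νG′ νH Δ′ mH mG′ s` (junction probe 1e4e131f4c6f2fb4 (P1)∕(P4), AUDIT S3#11).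

ED. 2 (R90-C12-typ2 (g2), pen of record from ED. 2): §0–§4 statements BYTE-FROZEN (ED. 1 b67b2192edb1, BUILT BW167, AUDIT S3#6); docstring page words lit4 (1807)(a)
(«(14.6.3) p. 243», «§1.6 p. 5»); imports + file C, ★ `R90S3SplitTransferTransport`, ★ `F0P3SpectralPacketHLawsSigned`, ★ `F0P3SpectralPacketHTrace`; §5–§6 added,
all PROVED (0 `sorry`).
NO socket, NO posited kit (kits occur only as BOUND variables of proved lemmas, §6), NO `∀ 𝔩` assertion, NO transfer-existence claim (JQ-S3-2), NO restatement of A1.  HONEST LABEL: transport book-keeping only — nothing printed in Ch. 13 is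
proved here; HC_CM is proved only modulo the 7 printed citations (2 remaining named inputs: hLiu418 = stmt-HodgeConjecture-24832, h413 = stmt-HodgeConjecture-24833)
until rung 0 closes; REL ≠ ★ ≠ BUILT.
-/

set_option autoImplicit false

noncomputable section

namespace Summit.HodgeConjecture.HodgeConjecture.R90.S3

open MeasureTheory IsDedekindDomain NumberField
open Literature.NumberTheory Literature.NumberTheory.Automorphic Literature.NumberTheory.Automorphic.UnitaryGroup
open Literature.NumberTheory.Rogawski1990 Literature.NumberTheory.GaloisRepresentations
open scoped Matrix

/-! ## §0 Reducible spellings of the carriers (no new notion: `abbrev`s unfolding to the ★ `cmDatum` carriers; `antidiag3 L = splitForm L 3`) -/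

variable (L : Type) [Field L] [NumberField L] [IsCMField L]

/-- `Φ₃` — the antidiagonal quasi-split form (★ spelling `Matrix.of fun i j : Fin 3 => if i.val + j.val + 1 = 3 then 1 else 0`). [cite: Rogawski1990, §14.2 p. 232] -/
abbrev antidiag3 : Matrix (Fin 3) (Fin 3) L := Matrix.of fun i j : Fin 3 => if i.val + j.val + 1 = 3 then (1 : L) else 0

/-- `H_v = U(Φ₂)(L⁺_v) × U(Φ₁)(L⁺_v)`. [cite: Rogawski1990, §12.1 p. 171] -/
abbrev CarrierH (v : HeightOneSpectrum (𝓞 ↥(maximalRealSubfield L))) : Type :=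
  (UnitaryGroup.cmDatum L 2 (Matrix.of fun i j : Fin 2 => if i.val + j.val + 1 = 2 then (1 : L) else 0)).Local v ×
    (UnitaryGroup.cmDatum L 1 (Matrix.of fun i j : Fin 1 => if i.val + j.val + 1 = 1 then (1 : L) else 0)).Local v

/-- `U(H)(L⁺_v)`. [cite: Rogawski1990, §14.2 p. 232] -/
abbrev CarrierG (H : Matrix (Fin 3) (Fin 3) L) (v : HeightOneSpectrum (𝓞 ↥(maximalRealSubfield L))) : Type :=
  (UnitaryGroup.cmDatum L 3 H).Local v

variable (v : HeightOneSpectrum (𝓞 ↥(maximalRealSubfield L)))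

/-! ## §1 (4.9.1)-matchings: homogeneity, and transport along the frame of record `e_v` with the sign `χ(a)` -/

/-- `Σᶠ_c Δ(γ_H, c)·Φ(c, z•f) = z · Σᶠ_c Δ(γ_H, c)·Φ(c, f)` (★ `classOrbitalIntegral_const_smul`, Mathlib `mul_finsum`). [cite: Rogawski1990, §4.3 (4.3.1) p. 43] -/
theorem finsum_delta_mul_classOrbitalIntegral_const_smul {X : Matrix (Fin 3) (Fin 3) L}
    [∀ γ : CarrierG L X v, MeasurableSpace (CarrierG L X v ⧸ Subgroup.centralizer ({γ} : Set (CarrierG L X v)))]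
    (Δ : LocalTransferFactor L X v) (mG : OrbitalMeasureFamily (CarrierG L X v)) (z : ℂ) (f : CarrierG L X v → ℂ) (γH : CarrierH L v) :
    (∑ᶠ c : ConjClasses (CarrierG L X v), Δ.Δ γH (Quotient.out c) * classOrbitalIntegral mG (z • f) c) =
      z * ∑ᶠ c : ConjClasses (CarrierG L X v), Δ.Δ γH (Quotient.out c) * classOrbitalIntegral mG f c := by
  rw [mul_finsum]
  exact finsum_congr fun c => by rw [classOrbitalIntegral_const_smul, mul_left_comm]

/-- **Moving a sign across a matching**: `(f^H, z•f)` `Δ`-matched and `z² = 1` ⇒ `(z•f^H, f)` `Δ`-matched. [cite: Rogawski1990, §4.3 (4.3.1) p. 43] -/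
theorem isLocalDeltaTransfer_smul_of_smul {X : Matrix (Fin 3) (Fin 3) L}
    [∀ γH : CarrierH L v, MeasurableSpace (CarrierH L v ⧸ Subgroup.centralizer ({γH} : Set (CarrierH L v)))]
    [∀ γ : CarrierG L X v, MeasurableSpace (CarrierG L X v ⧸ Subgroup.centralizer ({γ} : Set (CarrierG L X v)))]
    (Δ : LocalTransferFactor L X v) (mH : OrbitalMeasureFamily (CarrierH L v)) (mG : OrbitalMeasureFamily (CarrierG L X v)) {z : ℂ} (hz : z * z = 1)
    {fH : CarrierH L v → ℂ} {f : CarrierG L X v → ℂ} (ht : IsLocalDeltaTransfer L X v Δ mH mG fH (z • f)) :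
    IsLocalDeltaTransfer L X v Δ mH mG (z • fH) f := by
  intro γH hreg
  rw [stableOrbitalIntegralRel_smul_fun, ht γH hreg, finsum_delta_mul_classOrbitalIntegral_const_smul, ← mul_assoc, hz, one_mul]

/-- **Scaling a matching**: `(f^H, f)` `Δ`-matched ⇒ `(z•f^H, z•f)` `Δ`-matched. [cite: Rogawski1990, §4.3 (4.3.1) p. 43] -/
theorem isLocalDeltaTransfer_smul_smul {X : Matrix (Fin 3) (Fin 3) L}
    [∀ γH : CarrierH L v, MeasurableSpace (CarrierH L v ⧸ Subgroup.centralizer ({γH} : Set (CarrierH L v)))]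
    [∀ γ : CarrierG L X v, MeasurableSpace (CarrierG L X v ⧸ Subgroup.centralizer ({γ} : Set (CarrierG L X v)))]
    (Δ : LocalTransferFactor L X v) (mH : OrbitalMeasureFamily (CarrierH L v)) (mG : OrbitalMeasureFamily (CarrierG L X v)) (z : ℂ)
    {fH : CarrierH L v → ℂ} {f : CarrierG L X v → ℂ} (ht : IsLocalDeltaTransfer L X v Δ mH mG fH f) :
    IsLocalDeltaTransfer L X v Δ mH mG (z • fH) (z • f) := by
  intro γH hreg
  rw [stableOrbitalIntegralRel_smul_fun, ht γH hreg, finsum_delta_mul_classOrbitalIntegral_const_smul]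

section Frame

variable (H : Matrix (Fin 3) (Fin 3) L) (T : GL (Fin 3) (UnitaryGroup.LocalRing L v)) {a : UnitaryGroup.LocalRing L v} (ha : IsUnit a)
  (h : formCongr (UnitaryGroup.conjLocal L (IsCMField.complexConj L) v) T (H.map (algebraMap L (UnitaryGroup.LocalRing L v))) =
    a • (Matrix.of fun i j : Fin 3 => if i.val + j.val + 1 = 3 then (1 : L) else 0).map (algebraMap L (UnitaryGroup.LocalRing L v)))

include T ha h in
open scoped Classical in
/-- **The frame sign `χ(a)` IS the form sign `ε_v(H)`** at a non-split `v` (★ `clauseSign_eq_intCast_formSignAt`, in the `ℤ`-cast currency of ★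
`finExplicitDelta_cmDatumLocalCongr_symm`). [cite: Rogawski1990, §14.6 p. 242; §3.5 Prop. 3.5.2 (c) p. 29] -/
theorem frameSign_eq_intCast_formSignAt (hH : (H.map (cmConjRingHom L))ᵀ = H) (hv : ∀ w : UnitaryGroup.PlacesOver L v, IsCMField.complexConj L • w.1 = w.1) :
    (((if ∃ z : UnitaryGroup.LocalRing L v, IsUnit z ∧ a = z * UnitaryGroup.conjLocal L (IsCMField.complexConj L) v z then (1 : ℤ) else -1 : ℤ) : ℂ)) =
      ((formSignAt L (IsCMField.complexConj L) H v : ℤ) : ℂ) := by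
  rw [← clauseSign_eq_intCast_formSignAt L H hH v hv T a ha h]
  split_ifs <;> simp

/-- `g ∈ C_c^∞(U(H)_v) ⇒ g ∘ e_v ∈ C_c^∞(U(Φ₃)_v)`. [cite: Rogawski1990, §14.4 p. 237; §1.6 p. 5] -/
theorem isLocSmooth_comp_frame {g : CarrierG L H v → ℂ} (hg : IsLocSmooth g) : IsLocSmooth (g ∘ UnitaryGroup.cmDatumLocalCongr L v T ha h) :=
  ⟨hg.1.comp_continuous (UnitaryGroup.cmDatumLocalCongr L v T ha h).continuous,
    hg.2.comp_homeomorph (UnitaryGroup.cmDatumLocalCongr L v T ha h).toHomeomorph⟩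

/-- `f ∈ C_c^∞(U(Φ₃)_v) ⇒ f ∘ e_v⁻¹ ∈ C_c^∞(U(H)_v)`. [cite: Rogawski1990, §14.4 p. 237; §1.6 p. 5] -/
theorem isLocSmooth_comp_frame_symm {f : CarrierG L (antidiag3 L) v → ℂ} (hf : IsLocSmooth f) :
    IsLocSmooth (f ∘ (UnitaryGroup.cmDatumLocalCongr L v T ha h).symm) :=
  ⟨hf.1.comp_continuous (UnitaryGroup.cmDatumLocalCongr L v T ha h).symm.continuous,
    hf.2.comp_homeomorph (UnitaryGroup.cmDatumLocalCongr L v T ha h).symm.toHomeomorph⟩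

open scoped Classical in
/-- **(4.9.1)-MATCHINGS TRANSPORT ALONG `e_v` WITH THE SIGN `χ(a)`** [§14.4 p. 237; (4.3.1)–(4.3.2) p. 43]: for the explicit factors of record `Δ‴_v^{H}`,
`Δ‴_v^{Φ₃}` (★ `finExplicitCollection`), a family `m′_G` on `U(H)_v`, and `e_v = cmDatumLocalCongr L v T ha h : U(Φ₃)_v ≃ U(H)_v`, `v` non-split:
`(f^H, g)` is `Δ‴^{H}`-matched for `(m_H, m′_G)` iff `(f^H, χ(a)·(g ∘ e_v))` is `Δ‴^{Φ₃}`-matched for `(m_H, (e_v⁻¹)_* m′_G)` — both say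
`Φ^st(γ_H, f^H) = Σᶠ_{c′} Δ‴^{H}(γ_H, c′) Φ(c′, g)` at every `G`-regular `γ_H` (★ `finsum_finExplicitDelta_mul_classOrbitalIntegral_transport`; `χ(a)² = 1`;
`χ_g(u)` is a unit at `G`-regular `γ_H`, ★ `isUnit_eval_finCharpolyTwo_of_isLocalGRegular`). [cite: Rogawski1990, §14.4 p. 237; §4.3 (4.3.1) p. 43; §4.9 p. 55] -/
theorem isLocalDeltaTransfer_finExplicit_transport_iff
    [∀ γH : CarrierH L v, MeasurableSpace (CarrierH L v ⧸ Subgroup.centralizer ({γH} : Set (CarrierH L v)))]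
    [∀ γ : CarrierG L H v, MeasurableSpace (CarrierG L H v ⧸ Subgroup.centralizer ({γ} : Set (CarrierG L H v)))]
    [∀ γ : CarrierG L H v, BorelSpace (CarrierG L H v ⧸ Subgroup.centralizer ({γ} : Set (CarrierG L H v)))]
    [∀ γ : CarrierG L (antidiag3 L) v, MeasurableSpace (CarrierG L (antidiag3 L) v ⧸ Subgroup.centralizer ({γ} : Set (CarrierG L (antidiag3 L) v)))]
    [∀ γ : CarrierG L (antidiag3 L) v, BorelSpace (CarrierG L (antidiag3 L) v ⧸ Subgroup.centralizer ({γ} : Set (CarrierG L (antidiag3 L) v)))]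
    (hv : ∀ w : UnitaryGroup.PlacesOver L v, IsCMField.complexConj L • w.1 = w.1)
    (hH : (H.map (cmConjRingHom L))ᵀ = H) (hHd : IsUnit H.det) (μ : HeckeCharacter L)
    (mH : OrbitalMeasureFamily (CarrierH L v)) (mG : OrbitalMeasureFamily (CarrierG L H v)) (fH : CarrierH L v → ℂ) (g : CarrierG L H v → ℂ) :
    IsLocalDeltaTransfer L H v (finExplicitCollection L H μ (finExplicitDelta_conj_left_all L H μ) (finExplicitDelta_conj_right_all L H μ) v) mH mG fH g ↔
      IsLocalDeltaTransfer L (antidiag3 L) v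
        (finExplicitCollection L (antidiag3 L) μ (finExplicitDelta_conj_left_all L (antidiag3 L) μ) (finExplicitDelta_conj_right_all L (antidiag3 L) μ) v) mH
        (mG.transport (UnitaryGroup.cmDatumLocalCongr L v T ha h).symm.toMulEquiv (UnitaryGroup.cmDatumLocalCongr L v T ha h).symm.continuous
          (UnitaryGroup.cmDatumLocalCongr L v T ha h).continuous) fH
        ((((if ∃ z : UnitaryGroup.LocalRing L v, IsUnit z ∧ a = z * UnitaryGroup.conjLocal L (IsCMField.complexConj L) v z then (1 : ℤ) else -1 : ℤ) : ℂ)) •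
          (g ∘ UnitaryGroup.cmDatumLocalCongr L v T ha h)) := by
  obtain ⟨w⟩ := UnitaryGroup.PlacesOver.nonempty L v
  have hw := hv w
  have haσ : UnitaryGroup.conjLocal L (IsCMField.complexConj L) v a = a :=
    conjLocal_eq_self_of_formCongr_eq_smul_antidiag L (by norm_num) hH v T h
  set ε : ℂ := (((if ∃ z : UnitaryGroup.LocalRing L v, IsUnit z ∧ a = z * UnitaryGroup.conjLocal L (IsCMField.complexConj L) v z then (1 : ℤ) else -1 : ℤ) : ℂ))
    with hε
  have hε2 : ε * ε = 1 := by
    rw [hε]; split_ifs <;> simp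
  refine forall₂_congr fun γH hreg => ?_
  have hu := isUnit_eval_finCharpolyTwo_of_isLocalGRegular L v γH hreg
  have key : (∑ᶠ c : ConjClasses (CarrierG L (antidiag3 L) v),
      (finExplicitCollection L (antidiag3 L) μ (finExplicitDelta_conj_left_all L (antidiag3 L) μ) (finExplicitDelta_conj_right_all L (antidiag3 L) μ) v).Δ γH
          (Quotient.out c) *
        classOrbitalIntegral
          (mG.transport (UnitaryGroup.cmDatumLocalCongr L v T ha h).symm.toMulEquiv (UnitaryGroup.cmDatumLocalCongr L v T ha h).symm.continuous
            (UnitaryGroup.cmDatumLocalCongr L v T ha h).continuous)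
          (g ∘ UnitaryGroup.cmDatumLocalCongr L v T ha h) c) =
      ε * ∑ᶠ c : ConjClasses (CarrierG L H v),
        (finExplicitCollection L H μ (finExplicitDelta_conj_left_all L H μ) (finExplicitDelta_conj_right_all L H μ) v).Δ γH (Quotient.out c) *
          classOrbitalIntegral mG g c :=
    finsum_finExplicitDelta_mul_classOrbitalIntegral_transport L v H T ha h w hw hH hHd.ne_zero haσ μ mG g γH hu
  rw [finsum_delta_mul_classOrbitalIntegral_const_smul, key, ← mul_assoc, hε2, one_mul]

/-! ## §2 Prop. 4.9.1 (a) on `C_c^∞` transports; canonical families and right Haar measures transport -/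

open scoped Classical in
/-- **PROP. 4.9.1 (a) ON `C_c^∞` TRANSPORTS ALONG `e_v`** [§14.4 p. 237]: local `Δ‴^{H}`-transfer exists for smooth test functions on `U(H)_v` (family `m′_G`) iff local
`Δ‴^{Φ₃}`-transfer exists for smooth test functions on `U(Φ₃)_v` (family `(e_v⁻¹)_* m′_G`) — push test functions through `e_v^{±1}` (§1; `χ(a)·f^H` is smooth,
`χ(a)² = 1`).  Feeds A1's `hT` at `Φ₃` from the consumer's transfer existence at `H`. [cite: Rogawski1990, §4.9 Prop. 4.9.1 (a) p. 55; §14.4 p. 237] -/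
theorem isLocalDeltaTransferExists_finExplicit_transport_iff
    [∀ γH : CarrierH L v, MeasurableSpace (CarrierH L v ⧸ Subgroup.centralizer ({γH} : Set (CarrierH L v)))]
    [∀ γ : CarrierG L H v, MeasurableSpace (CarrierG L H v ⧸ Subgroup.centralizer ({γ} : Set (CarrierG L H v)))]
    [∀ γ : CarrierG L H v, BorelSpace (CarrierG L H v ⧸ Subgroup.centralizer ({γ} : Set (CarrierG L H v)))]
    [∀ γ : CarrierG L (antidiag3 L) v, MeasurableSpace (CarrierG L (antidiag3 L) v ⧸ Subgroup.centralizer ({γ} : Set (CarrierG L (antidiag3 L) v)))]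
    [∀ γ : CarrierG L (antidiag3 L) v, BorelSpace (CarrierG L (antidiag3 L) v ⧸ Subgroup.centralizer ({γ} : Set (CarrierG L (antidiag3 L) v)))]
    (hv : ∀ w : UnitaryGroup.PlacesOver L v, IsCMField.complexConj L • w.1 = w.1)
    (hH : (H.map (cmConjRingHom L))ᵀ = H) (hHd : IsUnit H.det) (μ : HeckeCharacter L)
    (mH : OrbitalMeasureFamily (CarrierH L v)) (mG : OrbitalMeasureFamily (CarrierG L H v)) :
    IsLocalDeltaTransferExists L H v (finExplicitCollection L H μ (finExplicitDelta_conj_left_all L H μ) (finExplicitDelta_conj_right_all L H μ) v) mH mG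
        IsLocSmooth IsLocSmooth ↔
      IsLocalDeltaTransferExists L (antidiag3 L) v
        (finExplicitCollection L (antidiag3 L) μ (finExplicitDelta_conj_left_all L (antidiag3 L) μ) (finExplicitDelta_conj_right_all L (antidiag3 L) μ) v) mH
        (mG.transport (UnitaryGroup.cmDatumLocalCongr L v T ha h).symm.toMulEquiv (UnitaryGroup.cmDatumLocalCongr L v T ha h).symm.continuous
          (UnitaryGroup.cmDatumLocalCongr L v T ha h).continuous) IsLocSmooth IsLocSmooth := by
  set ε : ℂ := (((if ∃ z : UnitaryGroup.LocalRing L v, IsUnit z ∧ a = z * UnitaryGroup.conjLocal L (IsCMField.complexConj L) v z then (1 : ℤ) else -1 : ℤ) : ℂ))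
    with hε
  have hε2 : ε * ε = 1 := by
    rw [hε]; split_ifs <;> simp
  constructor
  · intro hT f hf
    -- `g := f ∘ e_v⁻¹` on `U(H)_v`; transfer it at `H`; push back with §1 and move the sign to the `H`-side
    obtain ⟨fH, hfH, ht⟩ := hT (f ∘ (UnitaryGroup.cmDatumLocalCongr L v T ha h).symm) (isLocSmooth_comp_frame_symm L v H T ha h hf)
    refine ⟨ε • fH, hfH.const_smul ε, ?_⟩
    have ht' := (isLocalDeltaTransfer_finExplicit_transport_iff L v H T ha h hv hH hHd μ mH mG fH _).1 ht
    have hfe : (f ∘ (UnitaryGroup.cmDatumLocalCongr L v T ha h).symm) ∘ (UnitaryGroup.cmDatumLocalCongr L v T ha h) = f := by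
      funext b; simp
    rw [hfe] at ht'
    exact isLocalDeltaTransfer_smul_of_smul L v _ mH _ hε2 ht'
  · intro hT g hg
    obtain ⟨fH, hfH, ht⟩ := hT (g ∘ UnitaryGroup.cmDatumLocalCongr L v T ha h) (isLocSmooth_comp_frame L v H T ha h hg)
    refine ⟨ε • fH, hfH.const_smul ε, ?_⟩
    exact (isLocalDeltaTransfer_finExplicit_transport_iff L v H T ha h hv hH hHd μ mH mG (ε • fH) g).2
      (isLocalDeltaTransfer_smul_smul L v _ mH _ ε ht)

/-- **The transported family `(e_v⁻¹)_* m′_G` is CANONICAL on the regular classes of `U(Φ₃)_v`** for the Haar measure `(e_v⁻¹)_* ν′` when `m′_G` is canonical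
for `ν′` (★ `transport_isCanonical_isRegularElt`; `e_v` is class-preserving, ★ `corresponds_cmDatumLocalCongr`) — A1's `hm.2` at `Φ₃`. [cite: Rogawski1990, §4.3 (4.3.1) p. 43; §14.2 p. 232] -/
theorem transport_isCanonical_of_record
    [MeasurableSpace (CarrierG L H v)] [BorelSpace (CarrierG L H v)]
    [MeasurableSpace (CarrierG L (antidiag3 L) v)] [BorelSpace (CarrierG L (antidiag3 L) v)]
    [∀ γ : CarrierG L H v, MeasurableSpace (CarrierG L H v ⧸ Subgroup.centralizer ({γ} : Set (CarrierG L H v)))]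
    [∀ γ : CarrierG L H v, BorelSpace (CarrierG L H v ⧸ Subgroup.centralizer ({γ} : Set (CarrierG L H v)))]
    [∀ γ : CarrierG L (antidiag3 L) v, MeasurableSpace (CarrierG L (antidiag3 L) v ⧸ Subgroup.centralizer ({γ} : Set (CarrierG L (antidiag3 L) v)))]
    [∀ γ : CarrierG L (antidiag3 L) v, BorelSpace (CarrierG L (antidiag3 L) v ⧸ Subgroup.centralizer ({γ} : Set (CarrierG L (antidiag3 L) v)))]
    (ν' : Measure (CarrierG L H v)) [ν'.IsHaarMeasure] [ν'.IsMulRightInvariant]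
    (ν : Measure (CarrierG L (antidiag3 L) v)) [ν.IsHaarMeasure] [ν.IsMulRightInvariant]
    (hν : ν = ν'.map (UnitaryGroup.cmDatumLocalCongr L v T ha h).symm)
    {mG : OrbitalMeasureFamily (CarrierG L H v)}
    (hm : mG.IsCanonical (fun γ => IsRegularElt (γ.val : GL (Fin 3) (UnitaryGroup.LocalRing L v))) ν') :
    (mG.transport (UnitaryGroup.cmDatumLocalCongr L v T ha h).symm.toMulEquiv (UnitaryGroup.cmDatumLocalCongr L v T ha h).symm.continuous
        (UnitaryGroup.cmDatumLocalCongr L v T ha h).continuous).IsCanonical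
      (fun γ => IsRegularElt (γ.val : GL (Fin 3) (UnitaryGroup.LocalRing L v))) ν :=
  transport_isCanonical_isRegularElt L H v (UnitaryGroup.cmDatumLocalCongr L v T ha h).symm
    (fun γ => corresponds_comm.1 (corresponds_cmDatumLocalCongr L v T ha h γ)) ν' ν hν hm

end Frame

/-- **Right Haar data transport**: the push-forward of a right-invariant measure along a continuous group isomorphism is right-invariant (the Haar property
itself is Mathlib's instance `ContinuousMulEquiv.isHaarMeasure_map`) — A1's `[νG.IsMulRightInvariant]` at `νG := (e_v⁻¹)_* ν′`. [cite: DeitmarEchterhoff2014, Thm. 1.5.3] -/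
theorem isMulRightInvariant_map_continuousMulEquiv {A B : Type*} [Group A] [Group B] [TopologicalSpace A] [TopologicalSpace B]
    [MeasurableSpace A] [MeasurableSpace B] [BorelSpace A] [BorelSpace B] [IsTopologicalGroup A] [IsTopologicalGroup B]
    (e : A ≃ₜ* B) (ν : Measure A) [ν.IsMulRightInvariant] : (ν.map e).IsMulRightInvariant := by
  have hme : Measurable (fun x : A => e x) := e.continuous.measurable
  refine ⟨fun b => ?_⟩
  rw [Measure.map_map (measurable_mul_const b) hme]
  have hcomp : ((fun x : B => x * b) ∘ fun x : A => e x) = (fun x : A => e x) ∘ fun x : A => x * e.symm b := by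
    funext x; simp [Function.comp, map_mul]
  rw [hcomp, ← Measure.map_map hme (measurable_mul_const _), map_mul_right_eq_self]

/-! ## §3 `c_loc` OF RECORD — EXPORT-EDGES row #9 (S7): the local sign of (14.6.3) is the form sign `ε_v(H)` -/

section CLoc

variable (H : Matrix (Fin 3) (Fin 3) L)

/-- **`c_loc(H, v) := ε_v(H) = formSignAt L c H v ∈ {±1}`** — the sign `s v` of ★ `SpectralPacketH.CharIdentityψS` ∕ (KT2″), i.e. the local constant of
(14.6.3) p. 243 carried by `Δ‴_v` across the frame `e_v` (§1). [cite: Rogawski1990, §14.6 (14.6.3) p. 243] -/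
def cLocOfRecord : ℤ := formSignAt L (IsCMField.complexConj L) H v

/-- `c_loc = formSignAt` (`rfl`). [cite: Rogawski1990, §14.6 (14.6.3) p. 243] -/
theorem cLocOfRecord_eq : cLocOfRecord L v H = formSignAt L (IsCMField.complexConj L) H v := rfl

/-- `c_loc² = 1` in `ℂ`. [cite: Rogawski1990, §14.6 (14.6.3) p. 243] -/
theorem intCast_cLocOfRecord_mul_self : ((cLocOfRecord L v H : ℤ) : ℂ) * ((cLocOfRecord L v H : ℤ) : ℂ) = 1 :=
  intCast_formSignAt_mul_self L H v

/-- `c_loc ≠ 0` in `ℂ`. [cite: Rogawski1990, §14.6 (14.6.3) p. 243] -/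
theorem intCast_cLocOfRecord_ne_zero : ((cLocOfRecord L v H : ℤ) : ℂ) ≠ 0 :=
  intCast_formSignAt_ne_zero L H v

/-- `c_loc = 1` at a split place. [cite: Rogawski1990, §14.6 (14.6.3) p. 243] -/
theorem intCast_cLocOfRecord_eq_one_of_split (hs : ∃ w : UnitaryGroup.PlacesOver L v, IsCMField.complexConj L • w.1 ≠ w.1) :
    ((cLocOfRecord L v H : ℤ) : ℂ) = 1 :=
  intCast_formSignAt_eq_one_of_split L H v hs

end CLoc

/-! ## §4 THE JUNCTION: an endoscopic expansion at the transported `Φ₃`-data gives the signed (KT2″) `v`-clause at `H` -/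

section Junction

variable (H : Matrix (Fin 3) (Fin 3) L) (T : GL (Fin 3) (UnitaryGroup.LocalRing L v)) {a : UnitaryGroup.LocalRing L v} (ha : IsUnit a)
  (h : formCongr (UnitaryGroup.conjLocal L (IsCMField.complexConj L) v) T (H.map (algebraMap L (UnitaryGroup.LocalRing L v))) =
    a • (Matrix.of fun i j : Fin 3 => if i.val + j.val + 1 = 3 then (1 : L) else 0).map (algebraMap L (UnitaryGroup.LocalRing L v)))

open scoped Classical in
/-- **THE JUNCTION LEMMA** [Thm. 13.1.1 (2) read on the inner form via §14.4 and (14.6.3)]: let `c : Irr(U(Φ₃)_v) →₀ ℤ` be an endoscopic expansion of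
`Σ_{σ∈ρ} tr σ` for the TRANSPORTED record data (`Δ‴^{Φ₃}`, `m_H`, `(e_v⁻¹)_* m′_G`, Haar `(e_v⁻¹)_* ν′`) — hypothesis `hc` is the body of file C's
`IsEndoExpansion L Φ₃ v (ν′.map e_v⁻¹) νH (Δ‴^{Φ₃} v) mH ((e_v⁻¹)_* m′_G) ρ c`, UNFOLDED (feed it by that `IsEndoExpansion` proof term itself).  Then for every
`Δ‴^{H}`-matched smooth pair `(f^H, g)` on `(H_v, U(H)_v)`:  `Σ_{σ∈ρ} tr σ(f^H) = c_loc(H, v) · Σ_π c(π) · tr π((e_v⁻¹)_* ν′; g ∘ e_v)` — the `v`-clause of ★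
`SpectralPacketH.CharIdentityψS` with `s v = cLocOfRecord L v H`, `ψ v = e_v⁻¹` (`g ∘ e_v = g ∘ (ψ v).symm`), `pair := c`, `mem (xiH ρ) := c.support`
(§1 transport + homogeneity of the admissible characters of `U(Φ₃)_v`: ★ `IrrClass.smoothTrace_smul_eq'`, ★ `localIrrepAdmissible_three_all`,
★ `nonarchimedeanGroup_unitaryGroupOfForm_local`). [cite: Rogawski1990, §13.1 Thm. 13.1.1 (2) p. 198; §14.4 p. 237; §14.6 (14.6.3) p. 243] -/
theorem kt2Clause_of_endoExpansion
    [MeasurableSpace (CarrierH L v)]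
    [∀ γH : CarrierH L v, MeasurableSpace (CarrierH L v ⧸ Subgroup.centralizer ({γH} : Set (CarrierH L v)))]
    [MeasurableSpace (CarrierG L H v)] [BorelSpace (CarrierG L H v)]
    [∀ γ : CarrierG L H v, MeasurableSpace (CarrierG L H v ⧸ Subgroup.centralizer ({γ} : Set (CarrierG L H v)))]
    [∀ γ : CarrierG L H v, BorelSpace (CarrierG L H v ⧸ Subgroup.centralizer ({γ} : Set (CarrierG L H v)))]
    [MeasurableSpace (CarrierG L (antidiag3 L) v)] [BorelSpace (CarrierG L (antidiag3 L) v)]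
    [∀ γ : CarrierG L (antidiag3 L) v, MeasurableSpace (CarrierG L (antidiag3 L) v ⧸ Subgroup.centralizer ({γ} : Set (CarrierG L (antidiag3 L) v)))]
    [∀ γ : CarrierG L (antidiag3 L) v, BorelSpace (CarrierG L (antidiag3 L) v ⧸ Subgroup.centralizer ({γ} : Set (CarrierG L (antidiag3 L) v)))]
    (hv : ∀ w : UnitaryGroup.PlacesOver L v, IsCMField.complexConj L • w.1 = w.1)
    (hH : (H.map (cmConjRingHom L))ᵀ = H) (hHd : IsUnit H.det) (μ : HeckeCharacter L)
    (νH : Measure (CarrierH L v)) (ν' : Measure (CarrierG L H v)) [ν'.IsHaarMeasure]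
    (mH : OrbitalMeasureFamily (CarrierH L v)) (mG : OrbitalMeasureFamily (CarrierG L H v))
    (ρ : Finset (IrrClass (CarrierH L v))) (c : IrrClass (CarrierG L (antidiag3 L) v) →₀ ℤ)
    (hc : ∀ (fH : CarrierH L v → ℂ) (f : CarrierG L (antidiag3 L) v → ℂ), IsLocSmooth fH → IsLocSmooth f →
      IsLocalDeltaTransfer L (antidiag3 L) v
        (finExplicitCollection L (antidiag3 L) μ (finExplicitDelta_conj_left_all L (antidiag3 L) μ) (finExplicitDelta_conj_right_all L (antidiag3 L) μ) v) mH
        (mG.transport (UnitaryGroup.cmDatumLocalCongr L v T ha h).symm.toMulEquiv (UnitaryGroup.cmDatumLocalCongr L v T ha h).symm.continuous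
          (UnitaryGroup.cmDatumLocalCongr L v T ha h).continuous) fH f →
      ∑ σ ∈ ρ, σ.smoothTrace νH fH =
        ∑ π ∈ c.support, (c π : ℂ) * π.smoothTrace (ν'.map (UnitaryGroup.cmDatumLocalCongr L v T ha h).symm) f)
    (fH : CarrierH L v → ℂ) (g : CarrierG L H v → ℂ) (hfH : IsLocSmooth fH) (hg : IsLocSmooth g)
    (ht : IsLocalDeltaTransfer L H v (finExplicitCollection L H μ (finExplicitDelta_conj_left_all L H μ) (finExplicitDelta_conj_right_all L H μ) v) mH mG fH g) :
    ∑ σ ∈ ρ, σ.smoothTrace νH fH =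
      ((cLocOfRecord L v H : ℤ) : ℂ) *
        ∑ π ∈ c.support, (c π : ℂ) * π.smoothTrace (ν'.map (UnitaryGroup.cmDatumLocalCongr L v T ha h).symm) (g ∘ UnitaryGroup.cmDatumLocalCongr L v T ha h) := by
  have hεs : (((if ∃ z : UnitaryGroup.LocalRing L v, IsUnit z ∧ a = z * UnitaryGroup.conjLocal L (IsCMField.complexConj L) v z then (1 : ℤ) else -1 : ℤ) : ℂ)) =
      ((cLocOfRecord L v H : ℤ) : ℂ) :=
    frameSign_eq_intCast_formSignAt L v H T ha h hH hv
  -- transport the matching (§1) and apply the expansion to `(f^H, χ(a) • (g ∘ e_v))`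
  have ht' := (isLocalDeltaTransfer_finExplicit_transport_iff L v H T ha h hv hH hHd μ mH mG fH g).1 ht
  have hge : IsLocSmooth (g ∘ UnitaryGroup.cmDatumLocalCongr L v T ha h) := isLocSmooth_comp_frame L v H T ha h hg
  have hexp := hc fH _ hfH (hge.const_smul _) ht'
  rw [hexp, ← hεs, Finset.mul_sum]
  refine Finset.sum_congr rfl fun π _ => ?_
  -- homogeneity of the admissible characters of `U(Φ₃)_v`
  haveI : NonarchimedeanGroup (CarrierG L (antidiag3 L) v) :=
    nonarchimedeanGroup_unitaryGroupOfForm_local (E := L) (c := IsCMField.complexConj L) (N := 3) (v := v)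
      (J' := (UnitaryGroup.adelicForm L 3 (antidiag3 L)).map (UnitaryGroup.adeleToLocal L v))
  have hadm : ∀ r : SmoothIrrep (CarrierG L (antidiag3 L) v), r.ρ.IsAdmissible := fun r =>
    (IrrClass.isAdmissible_mk r).1
      (Cruxes.H413.F0P3LocalIrrepAdmissibleThree.localIrrepAdmissible_three_all L (antidiag3 L)
        (UnitaryGroup.antidiagOne_isHermitian L 3) (UnitaryGroup.isUnit_antidiagOne_det L 3) v (IrrClass.mk r))
  rw [IrrClass.smoothTrace_smul_eq' (ν'.map (UnitaryGroup.cmDatumLocalCongr L v T ha h).symm) hadm π]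
  ring

end Junction

/-! ## §5 (ED. 2) THE JUNCTION AT EVERY FINITE PLACE (guard-free transport BY NAME, ★ `R90S3SplitTransferTransport`) AND WITH `hc` BY NAME
(R90-C12-typ2 (g2), S3 pen of record from ED. 2; dealer RULINGS R35 (1) (b3), S3-R5″∕R6∕R7; junction probe 1e4e131f4c6f2fb4, AUDIT S3#11; census K2E3-p36 (a)(b)) -/

section JunctionAllPlaces

variable (H : Matrix (Fin 3) (Fin 3) L) (T : GL (Fin 3) (UnitaryGroup.LocalRing L v)) {a : UnitaryGroup.LocalRing L v} (ha : IsUnit a)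
  (h : formCongr (UnitaryGroup.conjLocal L (IsCMField.complexConj L) v) T (H.map (algebraMap L (UnitaryGroup.LocalRing L v))) =
    a • (Matrix.of fun i j : Fin 3 => if i.val + j.val + 1 = 3 then (1 : L) else 0).map (algebraMap L (UnitaryGroup.LocalRing L v)))

open scoped Classical in
/-- **B4′ — THE JUNCTION LEMMA AT EVERY FINITE PLACE, NO GUARD** (ED. 2; RULING S3-R5″ (ii)): §4's statement with the non-split guard `hv` DROPPED — the
matching transports along `e_v` with the form sign `ε_v(H) = cLocOfRecord L v H` at EVERY finite `v` (★ `isLocalDeltaTransfer_finExplicit_transport_iff_formSignAt`,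
K2E3-p36 `Theorems/R90S3SplitTransferTransport.lean`: at a non-split `v` the frame sign `χ(a)` of §1, at a split `v` the sign `1` since `κ_v ≡ +1` there,
★ `finKappaAt_of_not_subsingleton`, [§4.9 p. 55, §14.6 p. 242]); then the expansion `hc` at the TRANSPORTED record data and homogeneity of the admissible
characters of `U(Φ₃)_v` exactly as in §4.  `hc` is file C's `IsEndoExpansion … ρ c` δ-unfolded (B5 feeds it by name). [cite: Rogawski1990, §13.1 Thm. 13.1.1 (2) p. 198; §14.4 p. 237; §14.6 (14.6.3) p. 243; §4.9 p. 55] -/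
theorem kt2Clause_of_endoExpansion_allPlaces
    [MeasurableSpace (CarrierH L v)]
    [∀ γH : CarrierH L v, MeasurableSpace (CarrierH L v ⧸ Subgroup.centralizer ({γH} : Set (CarrierH L v)))]
    [MeasurableSpace (CarrierG L H v)] [BorelSpace (CarrierG L H v)]
    [∀ γ : CarrierG L H v, MeasurableSpace (CarrierG L H v ⧸ Subgroup.centralizer ({γ} : Set (CarrierG L H v)))]
    [∀ γ : CarrierG L H v, BorelSpace (CarrierG L H v ⧸ Subgroup.centralizer ({γ} : Set (CarrierG L H v)))]
    [MeasurableSpace (CarrierG L (antidiag3 L) v)] [BorelSpace (CarrierG L (antidiag3 L) v)]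
    [∀ γ : CarrierG L (antidiag3 L) v, MeasurableSpace (CarrierG L (antidiag3 L) v ⧸ Subgroup.centralizer ({γ} : Set (CarrierG L (antidiag3 L) v)))]
    [∀ γ : CarrierG L (antidiag3 L) v, BorelSpace (CarrierG L (antidiag3 L) v ⧸ Subgroup.centralizer ({γ} : Set (CarrierG L (antidiag3 L) v)))]
    (hH : (H.map (cmConjRingHom L))ᵀ = H) (hHd : IsUnit H.det) (μ : HeckeCharacter L)
    (νH : Measure (CarrierH L v)) (ν' : Measure (CarrierG L H v)) [ν'.IsHaarMeasure]
    (mH : OrbitalMeasureFamily (CarrierH L v)) (mG : OrbitalMeasureFamily (CarrierG L H v))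
    (ρ : Finset (IrrClass (CarrierH L v))) (c : IrrClass (CarrierG L (antidiag3 L) v) →₀ ℤ)
    (hc : ∀ (fH : CarrierH L v → ℂ) (f : CarrierG L (antidiag3 L) v → ℂ), IsLocSmooth fH → IsLocSmooth f →
      IsLocalDeltaTransfer L (antidiag3 L) v
        (finExplicitCollection L (antidiag3 L) μ (finExplicitDelta_conj_left_all L (antidiag3 L) μ) (finExplicitDelta_conj_right_all L (antidiag3 L) μ) v) mH
        (mG.transport (UnitaryGroup.cmDatumLocalCongr L v T ha h).symm.toMulEquiv (UnitaryGroup.cmDatumLocalCongr L v T ha h).symm.continuous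
          (UnitaryGroup.cmDatumLocalCongr L v T ha h).continuous) fH f →
      ∑ σ ∈ ρ, σ.smoothTrace νH fH =
        ∑ π ∈ c.support, (c π : ℂ) * π.smoothTrace (ν'.map (UnitaryGroup.cmDatumLocalCongr L v T ha h).symm) f)
    (fH : CarrierH L v → ℂ) (g : CarrierG L H v → ℂ) (hfH : IsLocSmooth fH) (hg : IsLocSmooth g)
    (ht : IsLocalDeltaTransfer L H v (finExplicitCollection L H μ (finExplicitDelta_conj_left_all L H μ) (finExplicitDelta_conj_right_all L H μ) v) mH mG fH g) :
    ∑ σ ∈ ρ, σ.smoothTrace νH fH =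
      ((cLocOfRecord L v H : ℤ) : ℂ) *
        ∑ π ∈ c.support, (c π : ℂ) * π.smoothTrace (ν'.map (UnitaryGroup.cmDatumLocalCongr L v T ha h).symm) (g ∘ UnitaryGroup.cmDatumLocalCongr L v T ha h) := by
  -- transport the matching along `e_v` with the FORM SIGN at EVERY finite place (★ K2E3-p36 §6) and apply the expansion to `(f^H, ε_v(H) • (g ∘ e_v))`
  have ht' := (isLocalDeltaTransfer_finExplicit_transport_iff_formSignAt L v H T ha h hH hHd μ mH mG fH g).1 ht
  have hge : IsLocSmooth (g ∘ UnitaryGroup.cmDatumLocalCongr L v T ha h) := isLocSmooth_comp_frame L v H T ha h hg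
  have hexp := hc fH _ hfH (hge.const_smul _) ht'
  rw [hexp, cLocOfRecord_eq, Finset.mul_sum]
  refine Finset.sum_congr rfl fun π _ => ?_
  -- homogeneity of the admissible characters of `U(Φ₃)_v`
  haveI : NonarchimedeanGroup (CarrierG L (antidiag3 L) v) :=
    nonarchimedeanGroup_unitaryGroupOfForm_local (E := L) (c := IsCMField.complexConj L) (N := 3) (v := v)
      (J' := (UnitaryGroup.adelicForm L 3 (antidiag3 L)).map (UnitaryGroup.adeleToLocal L v))
  have hadm : ∀ r : SmoothIrrep (CarrierG L (antidiag3 L) v), r.ρ.IsAdmissible := fun r =>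
    (IrrClass.isAdmissible_mk r).1
      (Cruxes.H413.F0P3LocalIrrepAdmissibleThree.localIrrepAdmissible_three_all L (antidiag3 L)
        (UnitaryGroup.antidiagOne_isHermitian L 3) (UnitaryGroup.isUnit_antidiagOne_det L 3) v (IrrClass.mk r))
  rw [IrrClass.smoothTrace_smul_eq' (ν'.map (UnitaryGroup.cmDatumLocalCongr L v T ha h).symm) hadm π]
  ring

open scoped Classical in
/-- **B5 — B4′ WITH `hc` BY NAME, EVERY FINITE PLACE** (ED. 2, file C imported; RULING S3-R5″ (ii)): `hc : IsEndoExpansion L Φ₃ v ((e_v⁻¹)_* ν′) νH Δ‴^{Φ₃}_v mH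
((e_v⁻¹)_* m′_G) ρ c` (file C's predicate at the TRANSPORTED record data) gives the signed (KT2″) `v`-clause at `H` with the sign `cLocOfRecord L v H` — this is
`kt2Clause_of_endoExpansion_allPlaces` fed `hc` (the two spellings are definitionally equal).  The consumer instantiates `hc` with A1 (non-split `v`, via
C's `endoCoeff_spec`) or with A's split socket `stub_R90_S3_endoExpansion_exists_split` (split `v`, S3-R5″ (i)); B imports neither (hypothesis-first, L9).
[cite: Rogawski1990, §13.1 Thm. 13.1.1 (2) p. 198; §14.4 p. 237; §14.6 (14.6.3) p. 243] -/
theorem kt2Clause_of_isEndoExpansion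
    [MeasurableSpace (CarrierH L v)]
    [∀ γH : CarrierH L v, MeasurableSpace (CarrierH L v ⧸ Subgroup.centralizer ({γH} : Set (CarrierH L v)))]
    [MeasurableSpace (CarrierG L H v)] [BorelSpace (CarrierG L H v)]
    [∀ γ : CarrierG L H v, MeasurableSpace (CarrierG L H v ⧸ Subgroup.centralizer ({γ} : Set (CarrierG L H v)))]
    [∀ γ : CarrierG L H v, BorelSpace (CarrierG L H v ⧸ Subgroup.centralizer ({γ} : Set (CarrierG L H v)))]
    [MeasurableSpace (CarrierG L (antidiag3 L) v)] [BorelSpace (CarrierG L (antidiag3 L) v)]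
    [∀ γ : CarrierG L (antidiag3 L) v, MeasurableSpace (CarrierG L (antidiag3 L) v ⧸ Subgroup.centralizer ({γ} : Set (CarrierG L (antidiag3 L) v)))]
    [∀ γ : CarrierG L (antidiag3 L) v, BorelSpace (CarrierG L (antidiag3 L) v ⧸ Subgroup.centralizer ({γ} : Set (CarrierG L (antidiag3 L) v)))]
    (hH : (H.map (cmConjRingHom L))ᵀ = H) (hHd : IsUnit H.det) (μ : HeckeCharacter L)
    (νH : Measure (CarrierH L v)) (ν' : Measure (CarrierG L H v)) [ν'.IsHaarMeasure]
    (mH : OrbitalMeasureFamily (CarrierH L v)) (mG : OrbitalMeasureFamily (CarrierG L H v))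
    (ρ : Finset (IrrClass (CarrierH L v))) (c : IrrClass (CarrierG L (antidiag3 L) v) →₀ ℤ)
    (hc : IsEndoExpansion L (antidiag3 L) v (ν'.map (UnitaryGroup.cmDatumLocalCongr L v T ha h).symm) νH
      (finExplicitCollection L (antidiag3 L) μ (finExplicitDelta_conj_left_all L (antidiag3 L) μ) (finExplicitDelta_conj_right_all L (antidiag3 L) μ) v) mH
      (mG.transport (UnitaryGroup.cmDatumLocalCongr L v T ha h).symm.toMulEquiv (UnitaryGroup.cmDatumLocalCongr L v T ha h).symm.continuous
          (UnitaryGroup.cmDatumLocalCongr L v T ha h).continuous) ρ c)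
    (fH : CarrierH L v → ℂ) (g : CarrierG L H v → ℂ) (hfH : IsLocSmooth fH) (hg : IsLocSmooth g)
    (ht : IsLocalDeltaTransfer L H v (finExplicitCollection L H μ (finExplicitDelta_conj_left_all L H μ) (finExplicitDelta_conj_right_all L H μ) v) mH mG fH g) :
    ∑ σ ∈ ρ, σ.smoothTrace νH fH =
      ((cLocOfRecord L v H : ℤ) : ℂ) *
        ∑ π ∈ c.support, (c π : ℂ) * π.smoothTrace (ν'.map (UnitaryGroup.cmDatumLocalCongr L v T ha h).symm) (g ∘ UnitaryGroup.cmDatumLocalCongr L v T ha h) :=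
  kt2Clause_of_endoExpansion_allPlaces L v H T ha h hH hHd μ νH ν' mH mG ρ c hc fH g hfH hg ht

end JunctionAllPlaces

/-! ## §6 (ED. 2) THE CLAUSE IN ★ KIT CURRENCY (generic frame `ψ`, generic sign `s`, kit a BOUND variable) AND ITS ASSEMBLY TO THE LITERAL ★ (KT2″)
`SpectralPacketH.CharIdentityψS` — the by-import junction of probe 1e4e131f4c6f2fb4 (P1)∕(P4) made importable BY NAME for S4-A∕S7 -/

section KitCurrency

open Summit.HodgeConjecture.HodgeConjecture.Cruxes.H413.F0P3LocalPacketKit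
open Summit.HodgeConjecture.HodgeConjecture.Cruxes.H413.F0P3InnerFormClassificationV6 (splitForm)
open Summit.HodgeConjecture.HodgeConjecture.Cruxes.H413.F0P3SpectralPacket
open Summit.HodgeConjecture.HodgeConjecture.Cruxes.H413.F0P3GlobalPacket
open Summit.HodgeConjecture.HodgeConjecture.Cruxes.H413.F0P3ArchPacketKit

/-- **B7 — THE (KT2″) `v`-CLAUSE IN ★ KIT CURRENCY, GENERIC FRAME** (ED. 2): for ANY `ψ : U(H)_v ≃ₜ* U(Φ₃)_v`, sign `s`, kit `K` with `mem (xiH R) = c.support`, `pair R = ⇑c`, an endoscopic expansion `c` of `memH R` at the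
ψ-transported `Φ₃`-data `((ψ)_* ν′, Δ^Φ, m_H, m^Φ_G)`, and the matching transport `Δ′-matched (f^H, f′) ⇒ Δ^Φ-matched (f^H, s • (f′ ∘ ψ⁻¹))`:
`K.trPktH νH R f^H = s · K.endoTrPkt ((ψ)_* ν′) R (f′ ∘ ψ⁻¹)` — the (KT2″) `v`-clause of ★ `SpectralPacketH.CharIdentityψS`, token for token (★ `trPktH`∕`endoTrPkt` unfold by
`rfl`; `K` is a BOUND variable — no `∀ 𝔩` statement is asserted).  At the frame of record `ψ := e_v⁻¹`, `s := cLocOfRecord`: `htr` is ★ `isLocalDeltaTransfer_finExplicit_transport_iff_formSignAt` (every finite `v`; §5),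
`hexp` is A1 (non-split `v`) ∕ A's split socket (split `v`) + C `endoCoeff_spec`, `hmem`∕`hpair` are S4-A's `kitOfCoeff_mem_xiH`∕`kitOfCoeff_pair`. [cite: Rogawski1990, §13.1 Thm. 13.1.1 (2) p. 198; §14.6 (14.6.3) p. 243] -/
theorem kt2Clause_of_transport_of_isEndoExpansion (H : Matrix (Fin 3) (Fin 3) L)
    [MeasurableSpace (CarrierH L v)]
    [∀ γH : CarrierH L v, MeasurableSpace (CarrierH L v ⧸ Subgroup.centralizer ({γH} : Set (CarrierH L v)))]
    [MeasurableSpace (CarrierG L H v)] [BorelSpace (CarrierG L H v)]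
    [∀ γ : CarrierG L H v, MeasurableSpace (CarrierG L H v ⧸ Subgroup.centralizer ({γ} : Set (CarrierG L H v)))]
    [MeasurableSpace (CarrierG L (antidiag3 L) v)] [BorelSpace (CarrierG L (antidiag3 L) v)]
    [∀ γ : CarrierG L (antidiag3 L) v, MeasurableSpace (CarrierG L (antidiag3 L) v ⧸ Subgroup.centralizer ({γ} : Set (CarrierG L (antidiag3 L) v)))]
    (ψ : (UnitaryGroup.cmDatum L 3 H).Local v ≃ₜ* (UnitaryGroup.cmDatum L 3 (splitForm L 3)).Local v) (s : ℤ)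
    (νH : Measure (CarrierH L v)) (ν' : Measure (CarrierG L H v)) [ν'.IsHaarMeasure]
    (Δ' : LocalTransferFactor L H v) (ΔΦ : LocalTransferFactor L (antidiag3 L) v)
    (mH : OrbitalMeasureFamily (CarrierH L v)) (mG' : OrbitalMeasureFamily (CarrierG L H v))
    (mGΦ : OrbitalMeasureFamily (CarrierG L (antidiag3 L) v))
    (htr : ∀ (fH : CarrierH L v → ℂ) (g : CarrierG L H v → ℂ), IsLocSmooth fH → IsLocSmooth g →
      IsLocalDeltaTransfer L H v Δ' mH mG' fH g → IsLocalDeltaTransfer L (antidiag3 L) v ΔΦ mH mGΦ fH ((s : ℂ) • (g ∘ ψ.symm)))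
    (K : LocalPacketKit L (splitForm L 3) v) (R : K.PktH) (c : IrrClass (CarrierG L (antidiag3 L) v) →₀ ℤ)
    (hmem : K.mem (K.xiH R) = c.support) (hpair : K.pair R = ⇑c)
    (hexp : IsEndoExpansion L (antidiag3 L) v (ν'.map ψ) νH ΔΦ mH mGΦ (K.memH R) c)
    (fH : CarrierH L v → ℂ) (f' : CarrierG L H v → ℂ) (hfH : IsLocSmooth fH) (hf' : IsLocSmooth f')
    (ht : IsLocalDeltaTransfer L H v Δ' mH mG' fH f') :
    K.trPktH νH R fH = (s : ℂ) * K.endoTrPkt (ν'.map ψ) R (f' ∘ ψ.symm) := by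
  have hge : IsLocSmooth (f' ∘ ψ.symm) :=
    ⟨hf'.1.comp_continuous ψ.symm.continuous, hf'.2.comp_homeomorph ψ.symm.toHomeomorph⟩
  have h1 := hexp fH _ hfH (hge.const_smul _) (htr fH f' hfH hf' ht)
  show (∑ σ ∈ K.memH R, σ.smoothTrace νH fH) = (s : ℂ) * ∑ π ∈ K.mem (K.xiH R), (K.pair R π : ℂ) * π.smoothTrace (ν'.map ψ) (f' ∘ ψ.symm)
  rw [hmem, hpair, h1, Finset.mul_sum]
  refine Finset.sum_congr rfl fun π _ => ?_
  haveI : NonarchimedeanGroup (CarrierG L (antidiag3 L) v) :=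
    nonarchimedeanGroup_unitaryGroupOfForm_local (E := L) (c := IsCMField.complexConj L) (N := 3) (v := v)
      (J' := (UnitaryGroup.adelicForm L 3 (antidiag3 L)).map (UnitaryGroup.adeleToLocal L v))
  have hadm : ∀ r : SmoothIrrep (CarrierG L (antidiag3 L) v), r.ρ.IsAdmissible := fun r =>
    (IrrClass.isAdmissible_mk r).1
      (Cruxes.H413.F0P3LocalIrrepAdmissibleThree.localIrrepAdmissible_three_all L (antidiag3 L)
        (UnitaryGroup.antidiagOne_isHermitian L 3) (UnitaryGroup.isUnit_antidiagOne_det L 3) v (IrrClass.mk r))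
  rw [IrrClass.smoothTrace_smul_eq' (ν'.map ψ) hadm π]
  ring

/-- **B8 — (KT2″) ASSEMBLED: ★ `SpectralPacketH.CharIdentityψS` FROM PLACE-WISE TRANSPORT + EXPANSION** (ED. 2) — for a spectral `H`-packet `ρ` of ANY kit family `𝔩` (bound), ANY `ψ`, ANY sign `s`: if at every finite
`w` the kit reads `mem (xiH ρ_w) = (c w).support`, `pair ρ_w = ⇑(c w)` for an endoscopic expansion `c w` of `memH ρ_w` at the `ψ_w`-transported `Φ₃`-data, and
`Δ′_w`-matchings transport along `ψ_w` with the sign `s w`, then `ρ.CharIdentityψS ψ νG′ νH Δ′ mH mG′ s` — the ★ predicate itself (quotient σ-algebras `borel`, as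
in the def). [cite: Rogawski1990, §13.1 Thm. 13.1.1 (2) p. 198; §14.6 (14.6.3) pp. 243–244] -/
theorem charIdentityψS_of_transport_of_isEndoExpansion
    {H : Matrix (Fin 3) (Fin 3) L}
    {𝔩 : ∀ w : HeightOneSpectrum (𝓞 ↥(maximalRealSubfield L)), LocalPacketKit L (splitForm L 3) w}
    {𝔞 : ArchPacketKit} {𝔞H : ArchPacketKitH 𝔞} {DiscH : GlobalPacketH 𝔩 → 𝔞H.PktInfH → Prop}
    (ρ : SpectralPacketH 𝔩 𝔞 𝔞H DiscH)
    (ψ : ∀ w : HeightOneSpectrum (𝓞 ↥(maximalRealSubfield L)),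
      (UnitaryGroup.cmDatum L 3 H).Local w ≃ₜ* (UnitaryGroup.cmDatum L 3 (splitForm L 3)).Local w)
    [∀ w : HeightOneSpectrum (𝓞 ↥(maximalRealSubfield L)), MeasurableSpace ((UnitaryGroup.cmDatum L 3 (splitForm L 3)).Local w)]
    [∀ w : HeightOneSpectrum (𝓞 ↥(maximalRealSubfield L)), BorelSpace ((UnitaryGroup.cmDatum L 3 (splitForm L 3)).Local w)]
    [∀ w : HeightOneSpectrum (𝓞 ↥(maximalRealSubfield L)), MeasurableSpace ((UnitaryGroup.cmDatum L 3 H).Local w)]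
    [∀ w : HeightOneSpectrum (𝓞 ↥(maximalRealSubfield L)), BorelSpace ((UnitaryGroup.cmDatum L 3 H).Local w)]
    [∀ w : HeightOneSpectrum (𝓞 ↥(maximalRealSubfield L)),
      MeasurableSpace ((UnitaryGroup.cmDatum L 2 (splitForm L 2)).Local w × (UnitaryGroup.cmDatum L 1 (splitForm L 1)).Local w)]
    (νG' : ∀ w : HeightOneSpectrum (𝓞 ↥(maximalRealSubfield L)), Measure ((UnitaryGroup.cmDatum L 3 H).Local w))
    [∀ w : HeightOneSpectrum (𝓞 ↥(maximalRealSubfield L)), (νG' w).IsHaarMeasure]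
    (νH : ∀ w : HeightOneSpectrum (𝓞 ↥(maximalRealSubfield L)),
      Measure ((UnitaryGroup.cmDatum L 2 (splitForm L 2)).Local w × (UnitaryGroup.cmDatum L 1 (splitForm L 1)).Local w))
    (Δ' : ∀ w : HeightOneSpectrum (𝓞 ↥(maximalRealSubfield L)), LocalTransferFactor L H w)
    (ΔΦ : ∀ w : HeightOneSpectrum (𝓞 ↥(maximalRealSubfield L)), LocalTransferFactor L (antidiag3 L) w)
    (mH : letI : ∀ (w : HeightOneSpectrum (𝓞 ↥(maximalRealSubfield L)))
        (a : (UnitaryGroup.cmDatum L 2 (splitForm L 2)).Local w × (UnitaryGroup.cmDatum L 1 (splitForm L 1)).Local w),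
        MeasurableSpace (((UnitaryGroup.cmDatum L 2 (splitForm L 2)).Local w × (UnitaryGroup.cmDatum L 1 (splitForm L 1)).Local w) ⧸
          Subgroup.centralizer ({a} : Set ((UnitaryGroup.cmDatum L 2 (splitForm L 2)).Local w × (UnitaryGroup.cmDatum L 1 (splitForm L 1)).Local w))) :=
        fun _ _ => borel _;
      ∀ w : HeightOneSpectrum (𝓞 ↥(maximalRealSubfield L)),
        OrbitalMeasureFamily ((UnitaryGroup.cmDatum L 2 (splitForm L 2)).Local w × (UnitaryGroup.cmDatum L 1 (splitForm L 1)).Local w))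
    (mG' : letI : ∀ (w : HeightOneSpectrum (𝓞 ↥(maximalRealSubfield L))) (γ : (UnitaryGroup.cmDatum L 3 H).Local w),
        MeasurableSpace ((UnitaryGroup.cmDatum L 3 H).Local w ⧸ Subgroup.centralizer ({γ} : Set ((UnitaryGroup.cmDatum L 3 H).Local w))) := fun _ _ => borel _;
      ∀ w : HeightOneSpectrum (𝓞 ↥(maximalRealSubfield L)), OrbitalMeasureFamily ((UnitaryGroup.cmDatum L 3 H).Local w))
    (mGΦ : letI : ∀ (w : HeightOneSpectrum (𝓞 ↥(maximalRealSubfield L))) (γ : CarrierG L (antidiag3 L) w),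
        MeasurableSpace (CarrierG L (antidiag3 L) w ⧸ Subgroup.centralizer ({γ} : Set (CarrierG L (antidiag3 L) w))) := fun _ _ => borel _;
      ∀ w : HeightOneSpectrum (𝓞 ↥(maximalRealSubfield L)), OrbitalMeasureFamily (CarrierG L (antidiag3 L) w))
    (s : HeightOneSpectrum (𝓞 ↥(maximalRealSubfield L)) → ℤ)
    (c : ∀ w : HeightOneSpectrum (𝓞 ↥(maximalRealSubfield L)), IrrClass (CarrierG L (antidiag3 L) w) →₀ ℤ)
    (hmem : ∀ w, (𝔩 w).mem ((𝔩 w).xiH (ρ.fin.loc w)) = (c w).support)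
    (hpair : ∀ w, (𝔩 w).pair (ρ.fin.loc w) = ⇑(c w))
    (htr : letI : ∀ (w : HeightOneSpectrum (𝓞 ↥(maximalRealSubfield L)))
        (a : (UnitaryGroup.cmDatum L 2 (splitForm L 2)).Local w × (UnitaryGroup.cmDatum L 1 (splitForm L 1)).Local w),
        MeasurableSpace (((UnitaryGroup.cmDatum L 2 (splitForm L 2)).Local w × (UnitaryGroup.cmDatum L 1 (splitForm L 1)).Local w) ⧸
          Subgroup.centralizer ({a} : Set ((UnitaryGroup.cmDatum L 2 (splitForm L 2)).Local w × (UnitaryGroup.cmDatum L 1 (splitForm L 1)).Local w))) :=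
        fun _ _ => borel _
      letI : ∀ (w : HeightOneSpectrum (𝓞 ↥(maximalRealSubfield L))) (γ : (UnitaryGroup.cmDatum L 3 H).Local w),
        MeasurableSpace ((UnitaryGroup.cmDatum L 3 H).Local w ⧸ Subgroup.centralizer ({γ} : Set ((UnitaryGroup.cmDatum L 3 H).Local w))) := fun _ _ => borel _
      letI : ∀ (w : HeightOneSpectrum (𝓞 ↥(maximalRealSubfield L))) (γ : CarrierG L (antidiag3 L) w),
        MeasurableSpace (CarrierG L (antidiag3 L) w ⧸ Subgroup.centralizer ({γ} : Set (CarrierG L (antidiag3 L) w))) := fun _ _ => borel _;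
      ∀ (w : HeightOneSpectrum (𝓞 ↥(maximalRealSubfield L)))
        (fH : (UnitaryGroup.cmDatum L 2 (splitForm L 2)).Local w × (UnitaryGroup.cmDatum L 1 (splitForm L 1)).Local w → ℂ)
        (g : (UnitaryGroup.cmDatum L 3 H).Local w → ℂ), IsLocSmooth fH → IsLocSmooth g →
        IsLocalDeltaTransfer L H w (Δ' w) (mH w) (mG' w) fH g →
          IsLocalDeltaTransfer L (antidiag3 L) w (ΔΦ w) (mH w) (mGΦ w) fH ((s w : ℂ) • (g ∘ (ψ w).symm)))
    (hexp : letI : ∀ (w : HeightOneSpectrum (𝓞 ↥(maximalRealSubfield L)))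
        (a : (UnitaryGroup.cmDatum L 2 (splitForm L 2)).Local w × (UnitaryGroup.cmDatum L 1 (splitForm L 1)).Local w),
        MeasurableSpace (((UnitaryGroup.cmDatum L 2 (splitForm L 2)).Local w × (UnitaryGroup.cmDatum L 1 (splitForm L 1)).Local w) ⧸
          Subgroup.centralizer ({a} : Set ((UnitaryGroup.cmDatum L 2 (splitForm L 2)).Local w × (UnitaryGroup.cmDatum L 1 (splitForm L 1)).Local w))) :=
        fun _ _ => borel _
      letI : ∀ (w : HeightOneSpectrum (𝓞 ↥(maximalRealSubfield L))) (γ : CarrierG L (antidiag3 L) w),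
        MeasurableSpace (CarrierG L (antidiag3 L) w ⧸ Subgroup.centralizer ({γ} : Set (CarrierG L (antidiag3 L) w))) := fun _ _ => borel _;
      ∀ w : HeightOneSpectrum (𝓞 ↥(maximalRealSubfield L)),
        IsEndoExpansion L (antidiag3 L) w ((νG' w).map (ψ w)) (νH w) (ΔΦ w) (mH w) (mGΦ w) ((𝔩 w).memH (ρ.fin.loc w)) (c w)) :
    ρ.CharIdentityψS ψ νG' νH Δ' mH mG' s := by
  intro w fH f' hfH hf' ht
  letI : ∀ a : (UnitaryGroup.cmDatum L 2 (splitForm L 2)).Local w × (UnitaryGroup.cmDatum L 1 (splitForm L 1)).Local w,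
      MeasurableSpace (((UnitaryGroup.cmDatum L 2 (splitForm L 2)).Local w × (UnitaryGroup.cmDatum L 1 (splitForm L 1)).Local w) ⧸
        Subgroup.centralizer ({a} : Set ((UnitaryGroup.cmDatum L 2 (splitForm L 2)).Local w × (UnitaryGroup.cmDatum L 1 (splitForm L 1)).Local w))) :=
    fun _ => borel _
  letI : ∀ γ : (UnitaryGroup.cmDatum L 3 H).Local w,
      MeasurableSpace ((UnitaryGroup.cmDatum L 3 H).Local w ⧸ Subgroup.centralizer ({γ} : Set ((UnitaryGroup.cmDatum L 3 H).Local w))) := fun _ => borel _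
  letI : ∀ γ : CarrierG L (antidiag3 L) w,
      MeasurableSpace (CarrierG L (antidiag3 L) w ⧸ Subgroup.centralizer ({γ} : Set (CarrierG L (antidiag3 L) w))) := fun _ => borel _
  exact kt2Clause_of_transport_of_isEndoExpansion L w H (ψ w) (s w) (νH w) (νG' w) (Δ' w) (ΔΦ w) (mH w) (mG' w) (mGΦ w) (htr w)
    (𝔩 w) (ρ.fin.loc w) (c w) (hmem w) (hpair w) (hexp w) fH f' hfH hf' ht

end KitCurrency

end Summit.HodgeConjecture.HodgeConjecture.R90.S3

end
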